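import Summits.QuantumFields.BalabanUV.Beta.RemainderExplicitWindowKernelWitness

/-!
# RemainderExplicitWindowKernelPeaks — ROAD P3: THE WINDOW LETTER IS A KERNEL LETTER (file 3 of 4: TROUGHS, PLATEAUX and the FAILURE OF THE
# WINDOW LETTER for the modulated harmonic transform `Tν(K) = Σ_{n<K} φ(n)μ_n∕(K − n)` of file 2; and ONE concrete log-Lipschitz modulation
# `φ(n) = (1 − cos(π·ln(n+1)∕ln 2))∕2` with troughs at `n + 1 = 4^i` and plateaux before `K + 1 = 2·4^i`)

Cell `pub-balaban`, BINDER row D4 «RemainderConst leaves for Bałaban's split» (owner lineage `b2b-balaban-beta-an4`; this file by co-owner #3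
lineage `b2b-balaban-beta-d4-p3`, road P3, generation 39), β-FLOW TEAM duty (1); FREEZE (0) honoured (def-free module in road P3's own
`RemainderExplicit*` series; no leaf, no interface, no Literature file).  SOURCE: [BalabanJaffe1986] Part III §4 p. 250 — nothing of it is
used or asserted here: LETTER-LEVEL real analysis with no run and no step function (objects and hypotheses `hμ hφ hΛ hT` as in file 2).
WHAT THIS FILE PROVES ([folklore]; 0 sorry, 0 `def`):
* §3 **`T_le_of_trough`** (`φ(n) = 0 ⟹ Tν(n) ≤ 1 + Λ`), **`T_ge_of_plateau`** (`φ ≥ 1∕2` whenever `3(K+1) ≤ 4(m+1) ≤ 4(K+1)` ⟹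
  `Tν(K) ≥ (μ_K∕2)(ln(K+1) − ln 4)`), **`not_window_of_peaks` — NO WINDOW MAJORANT: if for every i₀ there are `i₀ ≤ n < K`, `K + 1 ≤ 2(n+1)`, with a
  trough at n and a plateau before K, then `θ·Tν` (θ > 0) satisfies `|θTν(K) − θTν(n)| ≤ D + c′(ln K − ln n)` (all n ≤ K) for NO pair (D, c′)**.
* §4 THE COSINE MODULATION `φ(n) = (1 − cos(π·ln(n+1)∕ln 2))∕2` (a variable with defining hypothesis `hφdef`): `cosMod_mem` (`0 ≤ φ ≤ 1`),
  `cosMod_logLipschitz` (log-Lipschitz with `Λ = π∕(2 ln 2)`, Mathlib's `Real.abs_cos_sub_cos_le`), **`cosMod_peaks`** (for every i₀: `n + 1 = 4^i`,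
  `K + 1 = 2·4^i` with `i₀ ≤ n`: `φ(n) = 0` and `φ ≥ 1∕2` on the last quarter before K — `ln(m+1)∕ln 2 ∈ [2i + 1∕2, 2i + 1]`, where the cosine is ≤ 0).
HONEST FRAMING (BETA-SPEC §0.2, verbatim and binding). *"Discharging BetaPertH makes Bałaban's UV stability UNCONDITIONAL — a real
constructive-QFT result; it is NOT the continuum limit and NOT the Clay problem."*  THIS MODULE DISCHARGES NOTHING: a TOY transform for NOT-IN-PRINT
letters (N3-win ∕ N3-ker ∕ joint, declared); nothing of Bałaban's (1.22) or of Bałaban–Jaffe's β_n asserted, constructed or instantiated; row D4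
class UNCHANGED (critical-path width 0; instance 0∕1; D4 DISCHARGE NO DATE).  NOT [Balaban1987RG1] Theorem 2, NOT BetaPertH, NOT continuum, NOT
Clay.  HONEST DEPENDENCY: continuum YM on T⁴ ⇐ BetaPertH ∧ nine spine estimates (0/9 proved); BetaPertH ⇐ (D1) ∧ (D4) ∧ CAP+tail; G-an2-4
gates asym, D1 and NE2/3/4.
-/

noncomputable section

open Finset Real Filter Topology

namespace Summit.QuantumFields.BalabanUV.Beta.RemainderExplicitWindowKernelPeaks

open Summit.QuantumFields.BalabanUV.Beta.EriceFlowEnclosureBareCouplingSums (sum_range_reflect_sub sum_Ico_reflect_sub)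
open Summit.QuantumFields.BalabanUV.Beta.RemainderExplicitLogRate (sum_range_inv_succ_eq_harmonic)
open Summit.QuantumFields.BalabanUV.Beta.EriceRemainderEnclosureDriftLogRun (log_natCast_sub_nonneg)
open Summit.QuantumFields.BalabanUV.Beta.EriceRemainderEnclosureJointLetterProfile (mu_pos_le_one mu_sub_mem one_le_logShift)
open Summit.QuantumFields.BalabanUV.Beta.RemainderExplicitWindowKernelWitness (Lambda_nonneg nu_mem)

section transform

variable {μ φ T : ℕ → ℝ} {Λ : ℝ}
  (hμ : ∀ n : ℕ, μ n = 1 / Real.sqrt (1 + Real.log ((n : ℝ) + 1)))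
  (hφ : ∀ n : ℕ, 0 ≤ φ n ∧ φ n ≤ 1)
  (hΛ : ∀ m n : ℕ, m ≤ n → |φ n - φ m| ≤ Λ * (Real.log ((n : ℝ) + 1) - Real.log ((m : ℝ) + 1)))
  (hT : ∀ K : ℕ, T K = ∑ n ∈ range K, φ n * μ n / ((K : ℝ) - n))

/-! ## §3 Troughs, plateaux, and the failure of the window letter -/

include hμ hφ hΛ hT in
/-- **AT A TROUGH THE TRANSFORM IS BOUNDED**: `φ(n) = 0 ⟹ Tν(n) ≤ 1 + Λ`.  For `m < n`, `φ(m) ≤ Λ(ln(n+1) − ln(m+1)) ≤ Λ(n − m)∕(m+1)`, so the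
terms `m ≥ ⌊n∕2⌋` cost ≤ `Λ∕(⌊n∕2⌋ + 1)` each (at most `⌊n∕2⌋ + 1` of them) and the terms `m < ⌊n∕2⌋` cost ≤ `1∕(n − ⌊n∕2⌋)` each. [folklore] -/
theorem T_le_of_trough {n : ℕ} (hφn : φ n = 0) : T n ≤ 1 + Λ := by
  have hΛ0 := Lambda_nonneg hΛ
  set N := n / 2 with hN
  have hNn : N ≤ n := Nat.div_le_self n 2
  have hNN : N + N ≤ n := by omega
  have hnN : n ≤ 2 * N + 1 := by omega
  -- first half ≤ 1
  have h1 : ∑ m ∈ range N, φ m * μ m / ((n : ℝ) - m) ≤ 1 := by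
    rcases Nat.eq_zero_or_pos N with hN0 | hNpos
    · rw [hN0]; simp
    have hnNr : (N : ℝ) + N ≤ n := by exact_mod_cast hNN
    have hKN : (0 : ℝ) < (n : ℝ) - N := by
      have : (0 : ℝ) < N := by exact_mod_cast hNpos
      linarith
    calc ∑ m ∈ range N, φ m * μ m / ((n : ℝ) - m) ≤ ∑ _m ∈ range N, 1 / ((n : ℝ) - N) := by
          refine sum_le_sum fun m hm => ?_
          have hm' : (m : ℝ) ≤ N := by exact_mod_cast (mem_range.mp hm).le
          have hnm : (0 : ℝ) < (n : ℝ) - m := by linarith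
          obtain ⟨hν0, hνμ, hμ1⟩ := nu_mem hμ hφ m
          rw [div_le_div_iff₀ hnm hKN]
          nlinarith
      _ = N / ((n : ℝ) - N) := by rw [sum_const, card_range, nsmul_eq_mul, mul_one_div]
      _ ≤ 1 := by rw [div_le_one hKN]; linarith
  -- second half ≤ Λ
  have h2 : ∑ m ∈ Ico N n, φ m * μ m / ((n : ℝ) - m) ≤ Λ := by
    have hterm : ∀ m ∈ Ico N n, φ m * μ m / ((n : ℝ) - m) ≤ Λ / ((N : ℝ) + 1) := by
      intro m hm
      obtain ⟨hNm, hmn⟩ := Finset.mem_Ico.mp hm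
      have hm0 : (0 : ℝ) < (m : ℝ) + 1 := by positivity
      have hnm : (0 : ℝ) < (n : ℝ) - m := by
        have : (m : ℝ) + 1 ≤ n := by exact_mod_cast hmn
        linarith
      obtain ⟨hμ0, hμ1⟩ := mu_pos_le_one hμ m
      obtain ⟨hφ0, _⟩ := hφ m
      -- φ m ≤ Λ (n − m)/(m + 1)
      have hφm : φ m ≤ Λ * (((n : ℝ) - m) / ((m : ℝ) + 1)) := by
        have h := hΛ m n hmn.le
        rw [hφn, zero_sub, abs_neg, abs_of_nonneg hφ0] at h
        refine h.trans (mul_le_mul_of_nonneg_left ?_ hΛ0)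
        rw [← Real.log_div (by positivity) hm0.ne']
        have h2 := Real.log_le_sub_one_of_pos (show (0 : ℝ) < ((n : ℝ) + 1) / ((m : ℝ) + 1) by positivity)
        have e : ((n : ℝ) + 1) / ((m : ℝ) + 1) - 1 = ((n : ℝ) - m) / ((m : ℝ) + 1) := by field_simp; ring
        linarith
      have hNm' : (N : ℝ) + 1 ≤ (m : ℝ) + 1 := by exact_mod_cast Nat.add_le_add_right hNm 1
      calc φ m * μ m / ((n : ℝ) - m) ≤ Λ * (((n : ℝ) - m) / ((m : ℝ) + 1)) * 1 / ((n : ℝ) - m) :=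
            div_le_div_of_nonneg_right (mul_le_mul hφm hμ1 hμ0.le (by positivity)) hnm.le
        _ = Λ / ((m : ℝ) + 1) := by field_simp
        _ ≤ Λ / ((N : ℝ) + 1) := div_le_div_of_nonneg_left hΛ0 (by positivity) hNm'
    have hcard : ((Ico N n).card : ℝ) ≤ (N : ℝ) + 1 := by
      rw [Nat.card_Ico]; exact_mod_cast (by omega : n - N ≤ N + 1)
    calc ∑ m ∈ Ico N n, φ m * μ m / ((n : ℝ) - m) ≤ (Ico N n).card • (Λ / ((N : ℝ) + 1)) :=
          Finset.sum_le_card_nsmul _ _ _ hterm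
      _ ≤ ((N : ℝ) + 1) * (Λ / ((N : ℝ) + 1)) := by
          rw [nsmul_eq_mul]; exact mul_le_mul_of_nonneg_right hcard (by positivity)
      _ = Λ := by field_simp
  rw [hT, ← sum_range_add_sum_Ico _ hNn]
  linarith

include hμ hφ hT in
/-- **ON A PLATEAU THE TRANSFORM IS ≍ √(ln K)**: if `φ(m) ≥ 1∕2` whenever `3(K+1) ≤ 4(m+1)`, `m ≤ K`, then
`Tν(K) ≥ (μ_K∕2)(ln(K+1) − ln 4)` — keep the last `q = ⌊(K+1)∕4⌋` terms, where `φ(m)μ_m ≥ μ_K∕2`, and `Σ_{d=1}^{q} 1∕d = H_q ≥ ln(q+1) ≥ ln((K+1)∕4)`.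
[folklore] -/
theorem T_ge_of_plateau {K : ℕ} (hpl : ∀ m : ℕ, m ≤ K → 3 * (K + 1) ≤ 4 * (m + 1) → 1 / 2 ≤ φ m) :
    μ K / 2 * (Real.log ((K : ℝ) + 1) - Real.log 4) ≤ T K := by
  obtain ⟨hμK0, hμK1⟩ := mu_pos_le_one hμ K
  set q := (K + 1) / 4 with hq
  have hqK : q ≤ K := by omega
  have hKq : K - q ≤ K := Nat.sub_le K q
  -- the kept terms
  have hsub : ∑ m ∈ Ico (K - q) K, φ m * μ m / ((K : ℝ) - m) ≤ T K := by
    rw [hT]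
    refine sum_le_sum_of_subset_of_nonneg (fun m hm => ?_) fun m hm _ => ?_
    · exact mem_range.mpr (Finset.mem_Ico.mp hm).2
    · have : (m : ℝ) + 1 ≤ K := by exact_mod_cast mem_range.mp hm
      exact div_nonneg (nu_mem hμ hφ m).1 (by linarith)
  have hlow : ∑ m ∈ Ico (K - q) K, μ K / 2 * (1 / ((K : ℝ) - m)) ≤ ∑ m ∈ Ico (K - q) K, φ m * μ m / ((K : ℝ) - m) := by
    refine sum_le_sum fun m hm => ?_
    obtain ⟨hKqm, hmK⟩ := Finset.mem_Ico.mp hm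
    have hKm : (0 : ℝ) < (K : ℝ) - m := by
      have : (m : ℝ) + 1 ≤ K := by exact_mod_cast hmK
      linarith
    have hpm : 1 / 2 ≤ φ m := hpl m hmK.le (by omega)
    have hμm : μ K ≤ μ m := by linarith [(mu_sub_mem hμ hmK.le).1]
    rw [mul_one_div, div_le_div_iff_of_pos_right hKm]
    nlinarith
  have hharm : Real.log ((K : ℝ) + 1) - Real.log 4 ≤ ∑ m ∈ Ico (K - q) K, 1 / ((K : ℝ) - m) := by
    rw [sum_Ico_reflect_sub (fun x => 1 / x) hKq, Nat.sub_sub_self hqK, sum_range_inv_succ_eq_harmonic]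
    have h1 := log_add_one_le_harmonic q
    have hq1 : ((K : ℝ) + 1) / 4 ≤ (q : ℝ) + 1 := by
      have : K + 1 < 4 * (q + 1) := by omega
      have : ((K : ℝ) + 1) < 4 * ((q : ℝ) + 1) := by exact_mod_cast this
      linarith
    have h2 : Real.log ((K : ℝ) + 1) - Real.log 4 ≤ Real.log ((q : ℝ) + 1) := by
      rw [← Real.log_div (by positivity) (by norm_num)]
      exact Real.log_le_log (by positivity) hq1
    push_cast at h1
    linarith
  calc μ K / 2 * (Real.log ((K : ℝ) + 1) - Real.log 4) ≤ μ K / 2 * ∑ m ∈ Ico (K - q) K, 1 / ((K : ℝ) - m) :=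
        mul_le_mul_of_nonneg_left hharm (by positivity)
    _ = ∑ m ∈ Ico (K - q) K, μ K / 2 * (1 / ((K : ℝ) - m)) := by rw [mul_sum]
    _ ≤ _ := hlow.trans hsub

include hμ hφ hΛ hT in
/-- **NO WINDOW MAJORANT.**  Suppose that for every i₀ there are `i₀ ≤ n < K` with `K + 1 ≤ 2(n+1)`, a trough `φ(n) = 0` and a plateau
`φ ≥ 1∕2` on `3(K+1) ≤ 4(m+1) ≤ 4(K+1)`.  Then for `θ > 0` and EVERY pair (D, c′) the window letter
`∀ n ≤ K, |θTν(K) − θTν(n)| ≤ D + c′(ln K − ln n)` FAILS: along such pairs `ln K − ln n ≤ ln 3` while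
`Tν(K) − Tν(n) ≥ (μ_K∕2)(ln(K+1) − ln 4) − (1 + Λ) ≍ √(ln K)∕2 → ∞`. [folklore] -/
theorem not_window_of_peaks {θ : ℝ} (hθ : 0 < θ)
    (hpk : ∀ i₀ : ℕ, ∃ n K : ℕ, i₀ ≤ n ∧ n < K ∧ K + 1 ≤ 2 * (n + 1) ∧ φ n = 0 ∧
      ∀ m : ℕ, m ≤ K → 3 * (K + 1) ≤ 4 * (m + 1) → 1 / 2 ≤ φ m) (D c' : ℝ) :
    ¬ ∀ K n : ℕ, n ≤ K → |θ * T K - θ * T n| ≤ D + c' * (Real.log K - Real.log n) := by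
  intro hwin
  have hΛ0 := Lambda_nonneg hΛ
  have hD : 0 ≤ D := by
    have h0 := hwin 0 0 le_rfl
    rw [sub_self, abs_zero, sub_self, mul_zero, add_zero] at h0
    exact h0
  -- the level to beat
  set M₁ := (D + |c'| * Real.log 3) / θ + 1 + Λ with hM₁
  have hlog3 : 0 ≤ Real.log 3 := Real.log_nonneg (by norm_num)
  have hM₁0 : 0 ≤ M₁ := by
    have : 0 ≤ (D + |c'| * Real.log 3) / θ := div_nonneg (by positivity) hθ.le
    linarith
  set s₀ := 2 * (M₁ + 1 + Λ) + 3 with hs₀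
  obtain ⟨n, K, hi₀n, hnK, hK2, hφn, hpl⟩ := hpk ⌈Real.exp (s₀ ^ 2)⌉₊
  have hn1 : (1 : ℝ) ≤ (n : ℝ) + 1 := by linarith [(Nat.cast_nonneg n : (0 : ℝ) ≤ n)]
  have hK1 : (1 : ℝ) ≤ K := by exact_mod_cast Nat.succ_le_of_lt (lt_of_le_of_lt (Nat.zero_le n) hnK)
  -- s = √(1 + ln(K+1)) ≥ s₀
  set s := Real.sqrt (1 + Real.log ((K : ℝ) + 1)) with hs
  have hlogK1 : 0 ≤ Real.log ((K : ℝ) + 1) := Real.log_nonneg (by linarith)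
  have hss : s ^ 2 = 1 + Real.log ((K : ℝ) + 1) := Real.sq_sqrt (by linarith)
  have hs1 : 1 ≤ s := Real.one_le_sqrt.mpr (by linarith)
  have hsge : s₀ ≤ s := by
    have he : Real.exp (s₀ ^ 2) ≤ (K : ℝ) + 1 := by
      have h1 : Real.exp (s₀ ^ 2) ≤ (⌈Real.exp (s₀ ^ 2)⌉₊ : ℝ) := Nat.le_ceil _
      have h2 : (⌈Real.exp (s₀ ^ 2)⌉₊ : ℝ) ≤ n := by exact_mod_cast hi₀n
      have h3 : (n : ℝ) ≤ K := by exact_mod_cast hnK.le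
      linarith
    have hl : s₀ ^ 2 ≤ Real.log ((K : ℝ) + 1) := by
      have := Real.log_le_log (Real.exp_pos _) he
      rwa [Real.log_exp] at this
    have hs₀0 : 0 ≤ s₀ := by rw [hs₀]; linarith
    calc s₀ = Real.sqrt (s₀ ^ 2) := (Real.sqrt_sq hs₀0).symm
      _ ≤ s := Real.sqrt_le_sqrt (by linarith)
  -- the peak and the trough
  have hμK : μ K = 1 / s := by rw [hμ K]
  have hpeak := T_ge_of_plateau hμ hφ hT hpl
  have htrough := T_le_of_trough hμ hφ hΛ hT hφn
  have hlog4 : Real.log 4 < 2 := by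
    have h : Real.log 4 = 2 * Real.log 2 := by
      rw [show (4 : ℝ) = 2 ^ 2 by norm_num, Real.log_pow]; norm_num
    rw [h]; linarith [Real.log_two_lt_d9]
  have hgap : M₁ < μ K / 2 * (Real.log ((K : ℝ) + 1) - Real.log 4) - (1 + Λ) := by
    rw [hμK]
    have e : 1 / s / 2 * (Real.log ((K : ℝ) + 1) - Real.log 4) = (s ^ 2 - 1 - Real.log 4) / (2 * s) := by
      rw [hss]; field_simp; ring
    rw [e, lt_sub_iff_add_lt, lt_div_iff₀ (by positivity)]
    have key : (2 * (M₁ + 1 + Λ) + 3) * s ≤ s ^ 2 := by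
      rw [hs₀] at hsge
      nlinarith [hsge, hs1]
    nlinarith [key, hlog4, hs1, hM₁0, hΛ0]
  -- the window at (K, n)
  have hw := hwin K n hnK.le
  have hlogKn : Real.log (K : ℝ) - Real.log n ≤ Real.log 3 := by
    rcases Nat.eq_zero_or_pos n with hz | hp
    · subst hz
      have : K = 1 := by omega
      subst this
      norm_num
      exact hlog3
    · have hn0 : (0 : ℝ) < n := by exact_mod_cast hp
      have hn1' : (1 : ℝ) ≤ n := by exact_mod_cast hp
      rw [← Real.log_div (by positivity) hn0.ne']
      apply Real.log_le_log (by positivity)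
      rw [div_le_iff₀ hn0]
      have : (K : ℝ) + 1 ≤ 2 * ((n : ℝ) + 1) := by exact_mod_cast hK2
      linarith
  have hlogKn0 : 0 ≤ Real.log (K : ℝ) - Real.log n := log_natCast_sub_nonneg hnK.le
  have hcw : c' * (Real.log (K : ℝ) - Real.log n) ≤ |c'| * Real.log 3 := by
    calc c' * (Real.log (K : ℝ) - Real.log n) ≤ |c'| * (Real.log (K : ℝ) - Real.log n) :=
          mul_le_mul_of_nonneg_right (le_abs_self c') hlogKn0
      _ ≤ |c'| * Real.log 3 := mul_le_mul_of_nonneg_left hlogKn (abs_nonneg c')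
  have hup : θ * (T K - T n) ≤ D + |c'| * Real.log 3 := by
    have := (le_abs_self (θ * T K - θ * T n)).trans hw
    rw [← mul_sub] at this
    linarith
  have hdown : θ * M₁ < θ * (T K - T n) := by
    apply mul_lt_mul_of_pos_left _ hθ
    linarith
  have hM₁θ : θ * M₁ = D + |c'| * Real.log 3 + θ * (1 + Λ) := by
    rw [hM₁]; field_simp; ring
  have : 0 < θ * (1 + Λ) := by positivity
  linarith

end transform

/-! ## §4 One concrete log-Lipschitz modulation with troughs and plateaux: the cosine of `log₂(n+1)` -/

section cosine

variable {φ : ℕ → ℝ} (hφdef : ∀ n : ℕ, φ n = (1 - Real.cos (π * (Real.log ((n : ℝ) + 1) / Real.log 2))) / 2)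

include hφdef in
/-- `0 ≤ φ ≤ 1` for the cosine modulation. [folklore] -/
theorem cosMod_mem (n : ℕ) : 0 ≤ φ n ∧ φ n ≤ 1 := by
  rw [hφdef n]
  have h1 := Real.cos_le_one (π * (Real.log ((n : ℝ) + 1) / Real.log 2))
  have h2 := Real.neg_one_le_cos (π * (Real.log ((n : ℝ) + 1) / Real.log 2))
  constructor <;> linarith

include hφdef in
/-- The cosine modulation is LOG-LIPSCHITZ with `Λ = π∕(2 ln 2)` (Mathlib's `Real.abs_cos_sub_cos_le`). [folklore] -/
theorem cosMod_logLipschitz (m n : ℕ) (hmn : m ≤ n) :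
    |φ n - φ m| ≤ π / (2 * Real.log 2) * (Real.log ((n : ℝ) + 1) - Real.log ((m : ℝ) + 1)) := by
  have hl2 : 0 < Real.log 2 := Real.log_pos one_lt_two
  have hd0 : 0 ≤ Real.log ((n : ℝ) + 1) - Real.log ((m : ℝ) + 1) :=
    sub_nonneg.mpr (Real.log_le_log (by positivity) (by exact_mod_cast Nat.add_le_add_right hmn 1))
  set a := π * (Real.log ((n : ℝ) + 1) / Real.log 2) with ha
  set b := π * (Real.log ((m : ℝ) + 1) / Real.log 2) with hb
  have h := Real.abs_cos_sub_cos_le a b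
  have hab : a - b = π / Real.log 2 * (Real.log ((n : ℝ) + 1) - Real.log ((m : ℝ) + 1)) := by
    rw [ha, hb]; ring
  rw [hab, abs_of_nonneg (mul_nonneg (by positivity) hd0)] at h
  rw [hφdef n, hφdef m]
  have e : (1 - Real.cos a) / 2 - (1 - Real.cos b) / 2 = -((Real.cos a - Real.cos b) / 2) := by ring
  rw [e, abs_neg, abs_div, abs_two]
  calc |Real.cos a - Real.cos b| / 2 ≤ π / Real.log 2 * (Real.log ((n : ℝ) + 1) - Real.log ((m : ℝ) + 1)) / 2 :=
        div_le_div_of_nonneg_right h zero_le_two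
    _ = _ := by ring

include hφdef in
/-- **TROUGHS AND PLATEAUX OF THE COSINE MODULATION**: for every i₀, with `n + 1 = 4^{i₀}` and `K + 1 = 2·4^{i₀}` one has `i₀ ≤ n < K`,
`K + 1 ≤ 2(n+1)`, a trough `φ(n) = 0` (`cos(2i₀π) = 1`) and a plateau `φ(m) ≥ 1∕2` whenever `3(K+1) ≤ 4(m+1) ≤ 4(K+1)` (there
`log₂(m+1) − 2i₀ ∈ [log₂(3∕2), 1] ⊂ [1∕2, 1]`, so the cosine is `cos y`, `y ∈ [π∕2, π]`, hence ≤ 0). [folklore] -/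
theorem cosMod_peaks (i₀ : ℕ) : ∃ n K : ℕ, i₀ ≤ n ∧ n < K ∧ K + 1 ≤ 2 * (n + 1) ∧ φ n = 0 ∧
    ∀ m : ℕ, m ≤ K → 3 * (K + 1) ≤ 4 * (m + 1) → 1 / 2 ≤ φ m := by
  have hl2 : 0 < Real.log 2 := Real.log_pos one_lt_two
  have hP : 1 ≤ 4 ^ i₀ := Nat.one_le_pow _ _ (by norm_num)
  have hlt : i₀ < 4 ^ i₀ := Nat.lt_pow_self (by norm_num)
  have hlog4 : Real.log ((4 : ℝ) ^ i₀) = 2 * i₀ * Real.log 2 := by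
    rw [Real.log_pow, show (4 : ℝ) = 2 ^ 2 by norm_num, Real.log_pow]; push_cast; ring
  refine ⟨4 ^ i₀ - 1, 2 * 4 ^ i₀ - 1, by omega, by omega, by omega, ?_, ?_⟩
  · -- the trough: log₂(4^{i₀}) = 2 i₀ and cos(2 i₀ π) = 1
    rw [hφdef]
    have hcast : (((4 ^ i₀ - 1 : ℕ)) : ℝ) + 1 = (4 : ℝ) ^ i₀ := by
      rw [Nat.cast_sub hP]; push_cast; ring
    rw [hcast, hlog4]
    rw [mul_div_cancel_right₀ (2 * (i₀ : ℝ)) hl2.ne', show π * (2 * (i₀ : ℝ)) = (i₀ : ℝ) * (2 * π) by ring,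
      Real.cos_nat_mul_two_pi]
    norm_num
  · intro m hmK hm
    rw [hφdef m]
    -- K + 1 = 2·4^{i₀}; (3/2)·4^{i₀} ≤ m + 1 ≤ 2·4^{i₀}
    have hK : (((2 * 4 ^ i₀ - 1 : ℕ)) : ℝ) + 1 = 2 * (4 : ℝ) ^ i₀ := by
      rw [Nat.cast_sub (by omega : 1 ≤ 2 * 4 ^ i₀)]; push_cast; ring
    have hm1 : 3 * (2 * (4 : ℝ) ^ i₀) ≤ 4 * ((m : ℝ) + 1) := by
      have : ((3 * (2 * 4 ^ i₀ - 1 + 1) : ℕ) : ℝ) ≤ ((4 * (m + 1) : ℕ) : ℝ) := by exact_mod_cast hm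
      push_cast at this; rw [hK] at this; linarith
    have hm2 : (m : ℝ) + 1 ≤ 2 * (4 : ℝ) ^ i₀ := by
      have : (m : ℝ) + 1 ≤ (((2 * 4 ^ i₀ - 1 : ℕ)) : ℝ) + 1 := by exact_mod_cast Nat.add_le_add_right hmK 1
      rwa [hK] at this
    have hpow : (0 : ℝ) < (4 : ℝ) ^ i₀ := by positivity
    -- the reduced angle y = π (log₂(m+1) − 2 i₀)
    set x := Real.log ((m : ℝ) + 1) with hx
    have hxlo : Real.log 2 / 2 + 2 * i₀ * Real.log 2 ≤ x := by
      have h1 : Real.log (3 / 2 * (4 : ℝ) ^ i₀) ≤ x := Real.log_le_log (by positivity) (by linarith)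
      rw [Real.log_mul (by norm_num) hpow.ne', hlog4] at h1
      have h2 : Real.log 2 / 2 ≤ Real.log (3 / 2 : ℝ) := by
        have h4 : Real.log 2 ≤ Real.log ((3 / 2 : ℝ) ^ 2) := Real.log_le_log (by norm_num) (by norm_num)
        have h5 : Real.log ((3 / 2 : ℝ) ^ 2) = 2 * Real.log (3 / 2 : ℝ) := by
          rw [Real.log_pow]; push_cast; ring
        linarith
      linarith
    have hxhi : x ≤ Real.log 2 + 2 * i₀ * Real.log 2 := by
      have h1 : x ≤ Real.log (2 * (4 : ℝ) ^ i₀) := Real.log_le_log (by positivity) hm2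
      rw [Real.log_mul (by norm_num) hpow.ne', hlog4] at h1
      exact h1
    set y := π * (x / Real.log 2) - (i₀ : ℝ) * (2 * π) with hy
    have e : π * (x / Real.log 2) = y + (i₀ : ℝ) * (2 * π) := by rw [hy]; ring
    have hylo : π / 2 ≤ y := by
      rw [hy]
      have : π * (1 / 2 + 2 * (i₀ : ℝ)) ≤ π * (x / Real.log 2) := by
        apply mul_le_mul_of_nonneg_left _ Real.pi_pos.le
        rw [le_div_iff₀ hl2]; linarith
      linarith
    have hyhi : y ≤ π + π / 2 := by
      rw [hy]
      have : π * (x / Real.log 2) ≤ π * (1 + 2 * (i₀ : ℝ)) := by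
        apply mul_le_mul_of_nonneg_left _ Real.pi_pos.le
        rw [div_le_iff₀ hl2]; linarith
      linarith [Real.pi_pos]
    rw [e, Real.cos_add_nat_mul_two_pi]
    have hcos := Real.cos_nonpos_of_pi_div_two_le_of_le hylo hyhi
    linarith

end cosine

end Summit.QuantumFields.BalabanUV.Beta.RemainderExplicitWindowKernelPeaks

end
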